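import Summits.Ventures.PercRepro.C026MixedSlacks

/-!
# THEOREM A: ROW C-036 «SA¼» holds at every mark–`c` edge (p6, gen 15; mine-3 INBOX 03:56Z)

Let `e` join the probe `c` to the mark `a`.  With `e` forced open `c` reaches a mark surely
(`lift_true_B_eq_univ`), and `a ↔ b` iff `a ↔ b` or `c ↔ b` with `e` closed (`lift_true_A_eq`).  Writing
`M := P_0(c ↮ {a, b})`, `α := P_0(a ↮ b)` and `Y := P_0(c ↔ b ∧ a ↮ b)` (the row `bc|a` of `H − e`), the
pivotal differences are `I_D = M`, `I_A = Y`, the contracted slack is `f(H / e) = α − Y`, and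
`f(H − e) = 2 P_0(c ↔ {a,b} ∧ a ↮ b) − (1 − M) α ≥ 2 Y − (1 − M) α`.  So SA¼ at `e` follows from
`Y (4M − 1) ≤ M α`, which ONE Harris inequality gives: `Y ≤ P_0(c ↔ b) α ≤ (1 − M) α` and
`(1 − M)(4M − 1) ≤ M ⟺ (2M − 1)² ≥ 0` (`SAQuarter26_of_edge_ca`; equality at the hub, `M = ½`).
The `b`–`c` edges follow by the symmetry `a ↔ b` (`SAQuarter26_swap`, `SAQuarter26_of_markC`).

This is the first PROVED instance of C-036 on an edge class of all marked multigraphs at every weight.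
-/

namespace PercRepro

open Finset

section LiftUpper

variable {E : Type*} [DecidableEq E]

/-- Lifts preserve increasing events. -/
theorem isUpperSet_lift (e : E) (s : Bool) {X : Set (Config E)} (hX : IsUpperSet X) :
    IsUpperSet (lift e s X) := by
  intro ω ω' hle hω
  refine hX (fun e' => ?_) hω
  show Function.update ω e s e' ≤ Function.update ω' e s e'
  by_cases h : e' = e
  · subst h
    simp
  · rw [Function.update_of_ne h, Function.update_of_ne h]
    exact hle e'

end LiftUpper

namespace MultiGraph

variable {V E : Type*} (G : MultiGraph V E) [Fintype E] [DecidableEq E]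

omit [Fintype E] in
/-- With an edge joining `c` and `a` forced open, `c` reaches a mark surely. -/
theorem lift_true_B_eq_univ {e : E} {a c : V}
    (he : (G.fst e = a ∧ G.snd e = c) ∨ (G.fst e = c ∧ G.snd e = a)) (b : V) :
    lift e true (G.connEvent c a ∪ G.connEvent c b) = Set.univ := by
  ext ω
  simp only [Set.mem_univ, iff_true, mem_lift, Set.mem_union, mem_connEvent]
  left
  have hopen : Function.update ω e true e = true := by simp
  have hadj := G.openAdj_of_open e hopen
  rcases he with ⟨h1, h2⟩ | ⟨h1, h2⟩
  · rw [h1, h2] at hadj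
    exact (Conn.of_openAdj hadj).symm
  · rw [h1, h2] at hadj
    exact Conn.of_openAdj hadj

omit [Fintype E] in
/-- With an edge joining `c` and `a` forced open, `a ↔ b` iff `a ↔ b` or `c ↔ b` with `e` closed. -/
theorem lift_true_A_eq {e : E} {a c : V}
    (he : (G.fst e = a ∧ G.snd e = c) ∨ (G.fst e = c ∧ G.snd e = a)) (b : V) :
    lift e true (G.connEvent a b) =
      lift e false (G.connEvent a b) ∪ lift e false (G.connEvent c b) := by
  ext ω
  simp only [mem_lift, Set.mem_union, mem_connEvent]
  have h1 : Function.update ω e true = Function.update (Function.update ω e false) e true := by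
    rw [Function.update_idem]
  rw [h1, conn_update_true_iff]
  rcases he with ⟨hx, hy⟩ | ⟨hx, hy⟩
  · rw [hx, hy]
    constructor
    · rintro (h | ⟨_, h⟩ | ⟨_, h2⟩)
      · exact Or.inl h
      · exact Or.inr h
      · exact Or.inl h2
    · rintro (h | h)
      · exact Or.inl h
      · exact Or.inr (Or.inl ⟨Conn.refl G _ a, h⟩)
  · rw [hx, hy]
    constructor
    · rintro (h | ⟨_, h2⟩ | ⟨_, h⟩)
      · exact Or.inl h
      · exact Or.inl h2
      · exact Or.inr h
    · rintro (h | h)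
      · exact Or.inl h
      · exact Or.inr (Or.inr ⟨Conn.refl G _ a, h⟩)

/-- **THEOREM A** (mine-3, INBOX 03:56Z): SA¼ holds at every edge joining `c` to the mark `a`, at
every weight vector. -/
theorem SAQuarter26_of_edge_ca {p : E → ℝ} (hp : IsProb p) {e : E} {a c : V}
    (he : (G.fst e = a ∧ G.snd e = c) ∨ (G.fst e = c ∧ G.snd e = a)) (b : V) :
    G.SAQuarter26 p e a b c := by
  unfold SAQuarter26 SAConst26
  have hBt := G.lift_true_B_eq_univ he b
  have hAt := G.lift_true_A_eq he b
  have hD : G.pivD26 p e a b c = 1 - prob p (lift e false (G.connEvent c a ∪ G.connEvent c b)) := by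
    rw [pivD26_eq_rowsB, G.law3_zero_add_two_add_three, G.law3_zero_add_two_add_three,
      prob_update_one_eq_prob_lift, prob_update_zero_eq_prob_lift, hBt, prob_univ]
  have hsplit := prob_inter_add_prob_inter_compl p (lift e false (G.connEvent a b))ᶜ
    (lift e false (G.connEvent c b))
  have hA : G.pivA26 p e a b c =
      prob p ((lift e false (G.connEvent a b))ᶜ ∩ lift e false (G.connEvent c b)) := by
    rw [pivA26_eq_rowsAc, G.law3_two_add_three_add_four, G.law3_two_add_three_add_four,
      prob_update_one_eq_prob_lift, prob_update_zero_eq_prob_lift]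
    change prob p (lift e false (G.connEvent a b))ᶜ - prob p (lift e true (G.connEvent a b))ᶜ = _
    rw [hAt, Set.compl_union]
    linarith
  have hf11 : G.slack26 (Function.update p e 1) a b c =
      prob p (lift e false (G.connEvent a b))ᶜ -
        prob p ((lift e false (G.connEvent a b))ᶜ ∩ lift e false (G.connEvent c b)) := by
    rw [slack26_update_one_eq_mixedSlack]
    unfold mixedSlack
    rw [hBt, hAt, Set.univ_inter, prob_univ, Set.compl_union, one_mul]
    linarith
  have hf00 : G.slack26 (Function.update p e 0) a b c =
      2 * prob p (lift e false (G.connEvent c a ∪ G.connEvent c b) ∩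
          (lift e false (G.connEvent a b))ᶜ) -
        prob p (lift e false (G.connEvent c a ∪ G.connEvent c b)) *
          prob p (lift e false (G.connEvent a b))ᶜ := by
    rw [slack26_update_zero_eq_mixedSlack]
    rfl
  rw [hD, hA, hf11, hf00]
  have hsub : (lift e false (G.connEvent a b))ᶜ ∩ lift e false (G.connEvent c b) ⊆
      lift e false (G.connEvent c a ∪ G.connEvent c b) ∩ (lift e false (G.connEvent a b))ᶜ := by
    rintro ω ⟨h1, h2⟩
    exact ⟨Or.inr h2, h1⟩
  have hW := prob_mono hp hsub
  have hCbBf : prob p (lift e false (G.connEvent c b)) ≤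
      prob p (lift e false (G.connEvent c a ∪ G.connEvent c b)) :=
    prob_mono hp (fun _ h => Or.inr h)
  have hHarris : prob p (lift e false (G.connEvent c b) ∩ (lift e false (G.connEvent a b))ᶜ) ≤
      prob p (lift e false (G.connEvent c b)) * prob p (lift e false (G.connEvent a b))ᶜ :=
    harris_upper_lower hp (isUpperSet_lift e false (G.isUpperSet_connEvent c b))
      (isUpperSet_lift e false (G.isUpperSet_connEvent a b)).compl
  rw [Set.inter_comm] at hHarris
  have hα0 : 0 ≤ prob p (lift e false (G.connEvent a b))ᶜ := prob_nonneg hp _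
  have hY0 : 0 ≤ prob p ((lift e false (G.connEvent a b))ᶜ ∩ lift e false (G.connEvent c b)) :=
    prob_nonneg hp _
  have hBf0 : 0 ≤ prob p (lift e false (G.connEvent c a ∪ G.connEvent c b)) := prob_nonneg hp _
  have hBf1 : prob p (lift e false (G.connEvent c a ∪ G.connEvent c b)) ≤ 1 := prob_le_one hp _
  have hY' : prob p ((lift e false (G.connEvent a b))ᶜ ∩ lift e false (G.connEvent c b)) ≤
      prob p (lift e false (G.connEvent c a ∪ G.connEvent c b)) *
        prob p (lift e false (G.connEvent a b))ᶜ :=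
    le_trans hHarris (mul_le_mul_of_nonneg_right hCbBf hα0)
  set M := 1 - prob p (lift e false (G.connEvent c a ∪ G.connEvent c b)) with hM
  set Y := prob p ((lift e false (G.connEvent a b))ᶜ ∩ lift e false (G.connEvent c b)) with hY
  set α := prob p (lift e false (G.connEvent a b))ᶜ with hα
  set W := prob p (lift e false (G.connEvent c a ∪ G.connEvent c b) ∩
    (lift e false (G.connEvent a b))ᶜ) with hWdef
  have hM0 : 0 ≤ M := by rw [hM]; linarith
  have hM1 : M ≤ 1 := by rw [hM]; linarith
  have hY'' : Y ≤ (1 - M) * α := by rw [hM]; simpa using hY'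
  by_cases h4 : 4 * M - 1 ≤ 0
  · nlinarith [mul_nonneg hY0 (neg_nonneg.2 h4), mul_nonneg hM0 hα0]
  · have h4' : 0 ≤ 4 * M - 1 := by linarith
    nlinarith [mul_le_mul_of_nonneg_right hY'' h4', mul_nonneg hα0 (sq_nonneg (2 * M - 1))]

/-! ### The symmetry `a ↔ b` and the `b`–`c` edges -/

/-- The C-026 slack is symmetric in the marks `a`, `b`. -/
theorem slack26_swap_ab (p : E → ℝ) (a b c : V) : G.slack26 p a b c = G.slack26 p b a c := by
  have hs : G.sepEvent a b = G.sepEvent b a := by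
    unfold sepEvent
    rw [G.connEvent_comm a b]
  rw [slack26_eq_prob, slack26_eq_prob, Set.union_comm, hs]

/-- `I_D` is symmetric in the marks `a`, `b`. -/
theorem pivD26_swap_ab (p : E → ℝ) (e : E) (a b c : V) : G.pivD26 p e a b c = G.pivD26 p e b a c := by
  rw [pivD26_eq_rowsB, pivD26_eq_rowsB, G.law3_zero_add_two_add_three, G.law3_zero_add_two_add_three,
    G.law3_zero_add_two_add_three, G.law3_zero_add_two_add_three, Set.union_comm]

/-- `I_A` is symmetric in the marks `a`, `b`. -/
theorem pivA26_swap_ab (p : E → ℝ) (e : E) (a b c : V) : G.pivA26 p e a b c = G.pivA26 p e b a c := by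
  rw [pivA26_eq, pivA26_eq, G.connEvent_comm a b]

/-- SA¼ at `e` is symmetric in the marks `a`, `b`. -/
theorem SAQuarter26_swap (p : E → ℝ) (e : E) (a b c : V) :
    G.SAQuarter26 p e a b c ↔ G.SAQuarter26 p e b a c := by
  unfold SAQuarter26 SAConst26
  rw [G.slack26_swap_ab _ a b c, G.slack26_swap_ab _ a b c, G.pivD26_swap_ab, G.pivA26_swap_ab]

/-- SA¼ holds at every edge joining `c` to the mark `b`. -/
theorem SAQuarter26_of_edge_cb {p : E → ℝ} (hp : IsProb p) {e : E} {b c : V}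
    (he : (G.fst e = b ∧ G.snd e = c) ∨ (G.fst e = c ∧ G.snd e = b)) (a : V) :
    G.SAQuarter26 p e a b c :=
  (G.SAQuarter26_swap p e a b c).2 (G.SAQuarter26_of_edge_ca hp he a)

/-- **ROW C-036 at every mark–`c` edge**: SA¼ holds at every edge joining the probe `c` to one of the
marks `a`, `b`, on every marked multigraph at every weight vector. -/
theorem SAQuarter26_of_markC {p : E → ℝ} (hp : IsProb p) {e : E} {a b c : V}
    (he : ((G.fst e = a ∧ G.snd e = c) ∨ (G.fst e = c ∧ G.snd e = a)) ∨
      ((G.fst e = b ∧ G.snd e = c) ∨ (G.fst e = c ∧ G.snd e = b))) :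
    G.SAQuarter26 p e a b c := by
  rcases he with he | he
  · exact G.SAQuarter26_of_edge_ca hp he b
  · exact G.SAQuarter26_of_edge_cb hp he a

/-! ### The mark–mark edges and the loops -/

omit [Fintype E] in
/-- At an edge joining the marks `a`, `b`, opening `e` does not help `c` reach a mark. -/
theorem lift_true_B_eq_lift_false_of_edge_ab {e : E} {a b : V}
    (he : (G.fst e = a ∧ G.snd e = b) ∨ (G.fst e = b ∧ G.snd e = a)) (c : V) :
    lift e true (G.connEvent c a ∪ G.connEvent c b) =
      lift e false (G.connEvent c a ∪ G.connEvent c b) := by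
  ext ω
  simp only [mem_lift, Set.mem_union, mem_connEvent]
  have h1 : Function.update ω e true = Function.update (Function.update ω e false) e true := by
    rw [Function.update_idem]
  rw [h1, conn_update_true_iff, conn_update_true_iff]
  constructor
  · rcases he with ⟨hx, hy⟩ | ⟨hx, hy⟩ <;> rw [hx, hy]
    · rintro ((h | ⟨h, _⟩ | ⟨h, _⟩) | (h | ⟨h, _⟩ | ⟨h, _⟩))
      · exact Or.inl h
      · exact Or.inl h
      · exact Or.inr h
      · exact Or.inr h
      · exact Or.inl h
      · exact Or.inr h
    · rintro ((h | ⟨h, _⟩ | ⟨h, _⟩) | (h | ⟨h, _⟩ | ⟨h, _⟩))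
      · exact Or.inl h
      · exact Or.inr h
      · exact Or.inl h
      · exact Or.inr h
      · exact Or.inr h
      · exact Or.inl h
  · rintro (h | h)
    · exact Or.inl (Or.inl h)
    · exact Or.inr (Or.inl h)

omit [Fintype E] in
/-- At an edge joining the marks `a`, `b`, forcing `e` open makes `a ↔ b` sure. -/
theorem lift_true_A_eq_univ_of_edge_ab {e : E} {a b : V}
    (he : (G.fst e = a ∧ G.snd e = b) ∨ (G.fst e = b ∧ G.snd e = a)) :
    lift e true (G.connEvent a b) = Set.univ := by
  ext ω
  simp only [Set.mem_univ, iff_true, mem_lift, mem_connEvent]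
  have hopen : Function.update ω e true e = true := by simp
  have hadj := G.openAdj_of_open e hopen
  rcases he with ⟨h1, h2⟩ | ⟨h1, h2⟩
  · rw [h1, h2] at hadj
    exact Conn.of_openAdj hadj
  · rw [h1, h2] at hadj
    exact (Conn.of_openAdj hadj).symm

/-- **SA¼ at a mark–mark edge**: at an edge joining `a` and `b`, `I_D = 0` and `f(H / e) = 0`, so SA¼
reduces to C-026 for `H − e`. -/
theorem SAQuarter26_of_edge_ab {p : E → ℝ} {e : E} {a b c : V}
    (he : (G.fst e = a ∧ G.snd e = b) ∨ (G.fst e = b ∧ G.snd e = a))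
    (h0 : 0 ≤ G.slack26 (Function.update p e 0) a b c) : G.SAQuarter26 p e a b c := by
  unfold SAQuarter26 SAConst26
  have hD : G.pivD26 p e a b c = 0 := by
    rw [pivD26_eq_rowsB, G.law3_zero_add_two_add_three, G.law3_zero_add_two_add_three,
      prob_update_one_eq_prob_lift, prob_update_zero_eq_prob_lift,
      G.lift_true_B_eq_lift_false_of_edge_ab he c, sub_self]
  have hf11 : G.slack26 (Function.update p e 1) a b c = 0 := by
    rw [slack26_update_one_eq_mixedSlack]
    unfold mixedSlack
    rw [G.lift_true_A_eq_univ_of_edge_ab he, Set.compl_univ, Set.inter_empty, prob_empty]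
    ring
  rw [hD, hf11]
  linarith

omit [Fintype E] in
/-- At a loop, forcing `e` open or closed gives the same connections. -/
theorem lift_true_eq_lift_false_of_loop {e : E} (he : G.fst e = G.snd e) (u v : V) :
    lift e true (G.connEvent u v) = lift e false (G.connEvent u v) := by
  ext ω
  simp only [mem_lift, mem_connEvent]
  have h1 : Function.update ω e true = Function.update (Function.update ω e false) e true := by
    rw [Function.update_idem]
  rw [h1, conn_update_true_iff, he]
  constructor
  · rintro (h | ⟨h1, h2⟩ | ⟨h1, h2⟩)
    · exact h
    · exact h1.trans h2
    · exact h1.trans h2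
  · intro h
    exact Or.inl h

omit [Fintype E] in
/-- At a loop, the open and closed lifts of `B = {c ↔ a} ∪ {c ↔ b}` coincide. -/
theorem lift_true_B_eq_lift_false_of_loop {e : E} (he : G.fst e = G.snd e) (a b c : V) :
    lift e true (G.connEvent c a ∪ G.connEvent c b) =
      lift e false (G.connEvent c a ∪ G.connEvent c b) := by
  change lift e true (G.connEvent c a) ∪ lift e true (G.connEvent c b) =
    lift e false (G.connEvent c a) ∪ lift e false (G.connEvent c b)
  rw [G.lift_true_eq_lift_false_of_loop he c a, G.lift_true_eq_lift_false_of_loop he c b]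

/-- **SA¼ at a loop**: both minors coincide and the pivotal differences vanish, so SA¼ reduces to C-026
for `H − e`. -/
theorem SAQuarter26_of_loop {p : E → ℝ} {e : E} (he : G.fst e = G.snd e) {a b c : V}
    (h0 : 0 ≤ G.slack26 (Function.update p e 0) a b c) : G.SAQuarter26 p e a b c := by
  unfold SAQuarter26 SAConst26
  have hA : G.pivA26 p e a b c = 0 := by
    rw [pivA26_eq, prob_update_one_eq_prob_lift, prob_update_zero_eq_prob_lift,
      G.lift_true_eq_lift_false_of_loop he, sub_self]
  have hf11 : G.slack26 (Function.update p e 1) a b c =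
      G.slack26 (Function.update p e 0) a b c := by
    rw [slack26_update_one_eq_mixedSlack, slack26_update_zero_eq_mixedSlack]
    unfold mixedSlack
    rw [G.lift_true_B_eq_lift_false_of_loop he, G.lift_true_eq_lift_false_of_loop he]
  rw [hA, hf11]
  linarith

end MultiGraph

end PercRepro
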